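import Summits.BirchSwinnertonDyer.BirchSwinnertonDyer.Theorems.KimAtThreeDeepLowerKatoCiteOnly
import Literature.NumberTheory.PAdicHodge.DualExpEllipticTowerSelf
import HarnessLib

/-!
# The deep leaf of W2 BY NAME from NINE cite-only named facts — the (S5b) hypothesis dropped
# (cell `bsd-addord`, seat w2-c2 gen 10; route W2 `KimAtThreeKolyvagin`; `--supports stmt-BirchSwinnertonDyer-19075`, helper)

HONEST FRAMING.  Glue only (theorems; no definition, no instance, no `sorry`).  This file re-keys the six cite-only
closers of `KimAtThreeDeepLowerKatoCiteOnly` (p539270, TEN named-fact hypotheses) and the 19076 closer of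
`KimAtThreeDeepUpperCiteOnly` (p539377) WITHOUT the hypothesis `(hT : exists_smul_range_expStarCoord_iff_trace_log)`
(Kato II Thm. 1.4.1 + BK90 §3 at ONE `p`-adic field, (S5b)): by the Literature THEOREM
`PAdicHodge.exists_smul_range_expStarCoord_iff_trace_log_of_tower` (kim3 g17, p542762 — the tower fact (S5b-tower) at
the trivial tower `F = F₀` IS (S5b), a kernel theorem with no further input) it is supplied as
`hT := exists_smul_range_expStarCoord_iff_trace_log_of_tower hT₂`.  Every remaining hypothesis is a NAMED, CITE-ONLY
statement (a `def … : Prop` with a locator, unproved in the tree): the four leaves of the route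
(`SakamotoKolyvaginThree` [Sakamoto 2024 Thm. 4.4], `RankEqAnalyticRankLeOne` [Gross–Zagier–Kolyvagin],
`PoitouTateSelmerDuality` [Poitou–Tate], `CarayolLevelEqConductor` [Carayol 1986]) and FIVE `Literature/` facts — (P123)
`cupLogInjective_and_hasDualExp_of_isDeRham` [Kato II Prop. 1.2.3], (DR) `isDeRham_restrictedRationalTateRep` [Kato II
Ex. 1.3.5], (S5a) `expStarCoord_eq_zero_iff_kummer` [BK90 3.8/3.11], (S5b-tower)
`exists_smul_range_expStarCoord_tower_iff_trace_log` [Kato II Thm. 1.4.1 + BK90 3.8 at two levels], and Kato 2004 with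
DEFINED `exp*` values `Kato2004.exists_eulerSystem_definedExpStar_values` [(8.1.3), Prop. 8.12, §9.4, Thm. 9.7, Thm. 6.6 (1),
Ex. 13.3].  So: items 19075 / 19679 / 19076 / 19562 / the deep leaf `N11.KimAtThreeDeepPUB` rest on NINE cite-only
statements (four route leaves + five Literature facts) and item 20013 on FIVE; these theorems are CONDITIONAL results
(gate audit `proof.conditional`), close nothing unconditionally, book nothing; BSD is not proved by any of this.

References: [Kim2025RefinedTNC] Thm. 1.1; [Sakamoto2024] Thm. 4.4; [MazurRubin2004] Thm. 5.2.12; [Carayol1986];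
[Kato2004Asterisque] (8.1.3), Prop. 8.12, §9.4, Thm. 9.7, Thm. 6.6 (1), Ex. 13.3; [Kato1993LNM1553] II Prop. 1.2.3,
§1.2.4, Ex. 1.3.5, Thm. 1.4.1; [BlochKato1990] §3 Prop. 3.8, Ex. 3.11.
-/

noncomputable section

-- the cell's Theorems namespace `Summit.BirchSwinnertonDyer.BirchSwinnertonDyer.…` repeats the summit name by design (D-0017)
set_option linter.dupNamespace false

open Literature.NumberTheory.EllipticCurves Literature.NumberTheory.PAdicHodge
open Literature.NumberTheory.EllipticCurves.Kato2004
open Summit.BirchSwinnertonDyer.Rank1Residual.Additive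
open Summit.BirchSwinnertonDyer.BirchSwinnertonDyer.Theses.KimAtThreeKolyvagin
open Summit.BirchSwinnertonDyer.BirchSwinnertonDyer.Theorems
open Summit.BirchSwinnertonDyer.BirchSwinnertonDyer.Theorems.KimAtThreeDeepLowerKatoCiteOnly

namespace Summit.BirchSwinnertonDyer.BirchSwinnertonDyer.Theorems.KimAtThreeDeepLowerKatoCiteOnlyNine

/-- **Item `DefinedKatoUniformThree` (20013) from FIVE cite-only named facts** ((P123), (DR), (S5a), (S5b-tower),
Kato 2004 with defined `exp*`); (S5b) supplied by `exists_smul_range_expStarCoord_iff_trace_log_of_tower`. Conditional.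
[cite: Kato2004Asterisque, Thm. 12.5, (8.1.3), §9.4–9.7] [cite: Kato1993LNM1553, Ch. II Prop. 1.2.3, Thm. 1.4.1] [cite: BlochKato1990, §3] -/
theorem definedKatoUniformThree_of_fiveCites (hP : cupLogInjective_and_hasDualExp_of_isDeRham)
    (hDR : isDeRham_restrictedRationalTateRep) (hS : expStarCoord_eq_zero_iff_kummer)
    (hT₂ : exists_smul_range_expStarCoord_tower_iff_trace_log)
    (hLit : exists_eulerSystem_definedExpStar_values) :
    DefinedKatoUniformThree :=
  definedKatoUniformThree_of_cites hP hDR hS (exists_smul_range_expStarCoord_iff_trace_log_of_tower hT₂) hT₂ hLit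

variable (hSak : SakamotoKolyvaginThree) (hGZK : RankEqAnalyticRankLeOne) (hPT : PoitouTateSelmerDuality)
include hSak hGZK hPT

/-- ★★★ **Crux `DeepLowerAtThree` (19075) BY NAME from NINE cite-only named facts** (the four route leaves + (P123),
(DR), (S5a), (S5b-tower), Kato 2004 with defined `exp*`); (S5b) supplied by the Literature theorem
`exists_smul_range_expStarCoord_iff_trace_log_of_tower`. Conditional (module docstring).
[cite: Kato2004Asterisque, Thm. 12.5, (8.1.3), Prop. 8.12, §9.4–9.7, Thm. 6.6 (1), Ex. 13.3] [cite: Kim2025RefinedTNC, Thm 1.1]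
[cite: Sakamoto2024, Thm. 4.4 (1)(2) (p. 926)] [cite: Kato1993LNM1553, Ch. II Prop. 1.2.3, Thm. 1.4.1] [cite: BlochKato1990, §3] -/
theorem deepLowerAtThree_of_nineCites (hP : cupLogInjective_and_hasDualExp_of_isDeRham)
    (hDR : isDeRham_restrictedRationalTateRep) (hS : expStarCoord_eq_zero_iff_kummer)
    (hT₂ : exists_smul_range_expStarCoord_tower_iff_trace_log)
    (hLit : exists_eulerSystem_definedExpStar_values)
    (hlev : CarayolLevelEqConductor) :
    Summit.BirchSwinnertonDyer.BirchSwinnertonDyer.Theses.KimAtThreeKolyvagin.DeepLowerAtThree :=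
  deepLowerAtThree_of_cites hSak hGZK hPT hP hDR hS (exists_smul_range_expStarCoord_iff_trace_log_of_tower hT₂)
    hT₂ hLit hlev

/-- **Crux `DeepLowerAtThreeOffKatoStratum` (19679) BY NAME from the nine cite-only named facts minus Carayol.**
Conditional. [cite: Kato2004Asterisque, Thm. 12.5, §9.4–9.7] [cite: Kim2025RefinedTNC, Thm 1.1] [cite: Sakamoto2024, Thm. 4.4 (1)(2) (p. 926)] -/
theorem deepLowerAtThreeOffKatoStratum_of_nineCites (hP : cupLogInjective_and_hasDualExp_of_isDeRham)
    (hDR : isDeRham_restrictedRationalTateRep) (hS : expStarCoord_eq_zero_iff_kummer)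
    (hT₂ : exists_smul_range_expStarCoord_tower_iff_trace_log)
    (hLit : exists_eulerSystem_definedExpStar_values) :
    Summit.BirchSwinnertonDyer.BirchSwinnertonDyer.Theses.KimAtThreeKolyvagin.DeepLowerAtThreeOffKatoStratum :=
  deepLowerAtThreeOffKatoStratum_of_cites hSak hGZK hPT hP hDR hS
    (exists_smul_range_expStarCoord_iff_trace_log_of_tower hT₂) hT₂ hLit

/-- **`DeepLowerAtThree ∧ DeepUpperAtThree` (19075 ∧ 19076) from NINE cite-only named facts.** Conditional.
[cite: Kato2004Asterisque, Thm. 12.5, §9.4–9.7] [cite: Kim2025RefinedTNC, Thm 1.1] -/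
theorem deepLower_and_deepUpper_of_nineCites (hP : cupLogInjective_and_hasDualExp_of_isDeRham)
    (hDR : isDeRham_restrictedRationalTateRep) (hS : expStarCoord_eq_zero_iff_kummer)
    (hT₂ : exists_smul_range_expStarCoord_tower_iff_trace_log)
    (hLit : exists_eulerSystem_definedExpStar_values)
    (hlev : CarayolLevelEqConductor) :
    Summit.BirchSwinnertonDyer.BirchSwinnertonDyer.Theses.KimAtThreeKolyvagin.DeepLowerAtThree ∧
      Summit.BirchSwinnertonDyer.BirchSwinnertonDyer.Theses.KimAtThreeKolyvagin.DeepUpperAtThree :=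
  deepLower_and_deepUpper_of_cites hSak hGZK hPT hP hDR hS (exists_smul_range_expStarCoord_iff_trace_log_of_tower hT₂)
    hT₂ hLit hlev

/-- ★★ **Crux `DeepUpperAtThree` (19076, w2-c3's item; the NINE-fact twin of p539377
`KimAtThreeDeepUpperCiteOnly.deepUpperAtThree_of_lit_of_facts`, filed here on planner g24's routing 2026-08-27T15:28:53Z)
BY NAME from NINE cite-only named facts.** Conditional. [cite: Kim2025RefinedTNC, Thm 1.1]
[cite: Kato2004Asterisque, (8.1.3) (p. 180), Prop. 8.12 (p. 186), §9.4 and Thm. 9.7 (pp. 188–189), Thm. 6.6 (1) (p. 163), Ex. 13.3 (pp. 224–225)]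
[cite: Sakamoto2024, Thm. 4.4 (p. 926)] [cite: MazurRubin2004, Thm. 5.2.12] -/
theorem deepUpperAtThree_of_nineCites (hP : cupLogInjective_and_hasDualExp_of_isDeRham)
    (hDR : isDeRham_restrictedRationalTateRep) (hS : expStarCoord_eq_zero_iff_kummer)
    (hT₂ : exists_smul_range_expStarCoord_tower_iff_trace_log)
    (hLit : exists_eulerSystem_definedExpStar_values)
    (hlev : CarayolLevelEqConductor) :
    Summit.BirchSwinnertonDyer.BirchSwinnertonDyer.Theses.KimAtThreeKolyvagin.DeepUpperAtThree :=
  (deepLower_and_deepUpper_of_nineCites hSak hGZK hPT hP hDR hS hT₂ hLit hlev).2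

/-- **Crux `DeepUpperAtThreeOffKatoStratum` (19562) BY NAME from the nine cite-only named facts minus Carayol.**
Conditional. [cite: Kato2004Asterisque, Thm. 12.5, §9.4–9.7] [cite: Kim2025RefinedTNC, Thm 1.1] -/
theorem deepUpperAtThreeOffKatoStratum_of_nineCites (hP : cupLogInjective_and_hasDualExp_of_isDeRham)
    (hDR : isDeRham_restrictedRationalTateRep) (hS : expStarCoord_eq_zero_iff_kummer)
    (hT₂ : exists_smul_range_expStarCoord_tower_iff_trace_log)
    (hLit : exists_eulerSystem_definedExpStar_values) :
    Summit.BirchSwinnertonDyer.BirchSwinnertonDyer.Theses.KimAtThreeKolyvagin.DeepUpperAtThreeOffKatoStratum :=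
  deepUpperAtThreeOffKatoStratum_of_cites hSak hGZK hPT hP hDR hS
    (exists_smul_range_expStarCoord_iff_trace_log_of_tower hT₂) hT₂ hLit

/-- ★★ **`N11.KimAtThreeDeepPUB` (the deep form of B3 = N11@3) from NINE cite-only named facts.** Conditional;
nothing about BSD is proved. [cite: Kato2004Asterisque, Thm. 12.5, §9.4–9.7] [cite: Kim2025RefinedTNC, Thm 1.1] -/
theorem kimAtThreeDeepPUB_of_nineCites (hP : cupLogInjective_and_hasDualExp_of_isDeRham)
    (hDR : isDeRham_restrictedRationalTateRep) (hS : expStarCoord_eq_zero_iff_kummer)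
    (hT₂ : exists_smul_range_expStarCoord_tower_iff_trace_log)
    (hLit : exists_eulerSystem_definedExpStar_values)
    (hlev : CarayolLevelEqConductor) :
    Summit.BirchSwinnertonDyer.Rank1Residual.Additive.N11.KimAtThreeDeepPUB :=
  kimAtThreeDeepPUB_of_cites hSak hGZK hPT hP hDR hS (exists_smul_range_expStarCoord_iff_trace_log_of_tower hT₂)
    hT₂ hLit hlev

end Summit.BirchSwinnertonDyer.BirchSwinnertonDyer.Theorems.KimAtThreeDeepLowerKatoCiteOnlyNine

end
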